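import Summits.Ventures.PercRepro.C025ProfileThinRowF
import Summits.Ventures.PercRepro.C025ProfileThinTriangleE
import Summits.Ventures.PercRepro.C025ProfileThinGirthE
import Summits.Ventures.PercRepro.C025ProfileThinGirthFive
import Summits.Ventures.PercRepro.C025ProfileThinGirthSix

/-!
# THE THIN REGIME OF SIMPLE MATROIDS IS CLOSED FOR `q ≤ 35` (night-3 g15)
**THEOREM** `profileIneq_thin_simple` / `hallIneq_thin_simple`: for every `q ≤ 35` and every finite SIMPLE matroid (every set of `≤ 2`
points independent) in which every rank-`q` set has at most `q + 1` points, the row `(q, q+1)` of C-032 and its Hall form (C-033)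
hold — for EVERY `n`, with NO hypothesis on the circuits. The proof is the case split on the girth `g₀` (the size of a smallest circuit):
if every set of `≤ 6` points is independent (girth `≥ 7`, including the free matroids) the simple rule T(q, g, n) of `C025ProfileThinRowF`
applies with `g = 7` (`7 (q − 5) ≤ 6 (n − q − 1)` holds for `q ≤ 35` whenever a set is demanding, i.e. `n − q − 1 ≥ q`); otherwise a
dependent set of `≤ 6` points of minimum cardinality `g₀ ∈ {3, 4, 5, 6}` is a `g₀`-circuit with every smaller set independent, and the row
follows from the `g₀`-cascade theorem (`ThinTriangle.profileIneq_thinTriangle` for `g₀ = 3`, `q ≥ 4`; `profileIneq_thinFour`, `q ≥ 6`;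
`profileIneq_thinFive`, `q ≥ 9`; `profileIneq_thinSix`, `q ≥ 12`) or, below those thresholds, again from T(q, g₀, n)
(`g₀ (q + 2 − g₀) ≤ (g₀ − 1)(n − q − 1)` holds for `q ≤ g₀ (g₀ − 2)`, i.e. `q ≤ 3, 8, 15, 24`). `indep_of_forall_rkN`: the bridge from the
rank-form girth hypothesis of the cascade chain to the independence form of ThinRowF. The bound `q ≤ 35` is exactly where the simple rule
stops covering girth `≥ 7`; the next cascade (`g = 7`) would move it to `q ≤ 48`.
-/
open scoped Matroid
namespace PercRepro
open Set Finset ThmH Staged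
namespace ThinGirth
variable {α : Type} [DecidableEq α] {M : Matroid α} [M.Finite]

omit [DecidableEq α] in
/-- From «every subset of the ground set with `≤ g − 1` points has full rank» to Mathlib's «every subset of `M.E` of encard `< g` is
independent». -/
theorem indep_of_forall_rkN {g : ℕ} (hgirth : ∀ X ⊆ gr M, X.card + 1 ≤ g → rkN M X = X.card) :
    ∀ T ⊆ M.E, T.encard < g → M.Indep T := by
  intro T hTE hTg
  have hTfin : T.Finite := (M.ground_finite).subset hTE
  have hX : (hTfin.toFinset : Set α) = T := hTfin.coe_toFinset
  have hXg : hTfin.toFinset ⊆ gr M := by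
    intro x hx
    have hx' : x ∈ (hTfin.toFinset : Set α) := by exact_mod_cast hx
    rw [hX] at hx'
    have : x ∈ ((gr M : Finset α) : Set α) := by rw [coe_gr]; exact hTE hx'
    exact_mod_cast this
  have hXc : hTfin.toFinset.card + 1 ≤ g := by
    rw [hTfin.encard_eq_coe_toFinset_card] at hTg
    exact_mod_cast hTg
  have hr := hgirth _ hXg hXc
  have hind : M.Indep (hTfin.toFinset : Set α) := by
    rw [Matroid.indep_iff_eRk_eq_encard_of_finite (Finset.finite_toSet _), Set.encard_coe_eq_coe_finsetCard,
      ← rkN_eq_iff, hr]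
  rw [hX] at hind
  exact hind

/-- **THE THIN REGIME OF SIMPLE MATROIDS, `q ≤ 35`**: every finite simple matroid in which every rank-`q` set has at most `q + 1`
points satisfies the row `(q, q+1)` of (Π) and its Hall form, for every `n`. -/
theorem profileIneq_thin_simple (q : ℕ) (hq : q ≤ 35)
    (hsimple : ∀ T ⊆ M.E, T.encard ≤ 2 → M.Indep T)
    (hthin : ∀ X ⊆ gr M, rkN M X = q → X.card ≤ q + 1) :
    Profile.ProfileIneq M q (q + 1) ∧ Profile.HallIneq M q (q + 1) := by
  rcases Nat.lt_or_ge ((gr M).card - q - 1) q with hlt | hge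
  · exact ThinTriangle.profileIneq_of_small q hlt
  have hsimple' : ∀ X ⊆ gr M, X.card ≤ 2 → rkN M X = X.card := by
    intro X hXg hXc
    have hXE : (X : Set α) ⊆ M.E := by rw [← coe_gr]; exact_mod_cast hXg
    apply OneCircuit.rkN_eq_card_of_indep
    apply hsimple _ hXE
    rw [Set.encard_coe_eq_coe_finsetCard]
    exact_mod_cast hXc
  -- the size condition of the simple rule T(q, g, n) at `f ≥ q` and `q ≤ g (g − 2)`
  have hsize : ∀ g : ℕ, 3 ≤ g → q ≤ g * (g - 2) → g * (q + 2 - g) ≤ (g - 1) * ((gr M).card - q - 1) := by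
    intro g hg3 hqg
    calc g * (q + 2 - g) ≤ (g - 1) * q := by
          rcases Nat.lt_or_ge (q + 2) g with h | h
          · rw [Nat.sub_eq_zero_of_le h.le]; simp
          · obtain ⟨g', rfl⟩ : ∃ g', g = g' + 3 := ⟨g - 3, by omega⟩
            have e1 : q + 2 - (g' + 3) = q - (g' + 1) := by omega
            have e2 : g' + 3 - 1 = g' + 2 := by omega
            have e3 : g' + 3 - 2 = g' + 1 := by omega
            rw [e1, e2]
            rw [e3] at hqg
            have hq1 : g' + 1 ≤ q := by omega
            zify [hq1]
            nlinarith
      _ ≤ (g - 1) * ((gr M).card - q - 1) := Nat.mul_le_mul_left _ hge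
  by_cases hP : ∀ X ⊆ gr M, X.card ≤ 6 → rkN M X = X.card
  · -- girth `≥ 7`: the simple rule with `g = 7`
    have hg7 : ∀ T ⊆ M.E, T.encard < (7 : ℕ) → M.Indep T :=
      indep_of_forall_rkN (g := 7) (fun X hXg hXc => hP X hXg (by omega))
    have hs := hsize 7 (by norm_num) (by omega)
    exact ⟨ThinRow.profileIneq_succ_of_thin_size q 7 (by norm_num) hs hg7 hthin,
      ThinRow.hallIneq_succ_of_thin_size q 7 (by norm_num) hs hg7 hthin⟩
  · -- a dependent set of `≤ 6` points of minimum cardinality is a `g₀`-circuit, `3 ≤ g₀ ≤ 6`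
    push Not at hP
    obtain ⟨X₀, hX₀g, hX₀c, hX₀r⟩ := hP
    set S := (gr M).powerset.filter (fun X => X.card ≤ 6 ∧ rkN M X ≠ X.card) with hS
    have hX₀S : X₀ ∈ S := by
      rw [hS, Finset.mem_filter, Finset.mem_powerset]
      exact ⟨hX₀g, hX₀c, hX₀r⟩
    obtain ⟨C, hCS, hCmin⟩ := Finset.exists_min_image S Finset.card ⟨X₀, hX₀S⟩
    rw [hS, Finset.mem_filter, Finset.mem_powerset] at hCS
    obtain ⟨hCg, hCc6, hCr⟩ := hCS
    -- every smaller subset of the ground set has full rank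
    have hgirth : ∀ X ⊆ gr M, X.card + 1 ≤ C.card → rkN M X = X.card := by
      intro X hXg hXc
      by_contra hne
      have hXS : X ∈ S := by
        rw [hS, Finset.mem_filter, Finset.mem_powerset]
        exact ⟨hXg, by omega, hne⟩
      have := hCmin X hXS
      omega
    have hCrk : rkN M C + 1 = C.card := by
      have h1 : rkN M C ≤ C.card := rkN_le_card C
      have h2 : rkN M C ≠ C.card := hCr
      -- `C ∖ {c}` has full rank `|C| − 1`
      have hCpos : 0 < C.card := by
        by_contra h0
        push Not at h0
        have := rkN_le_card (M := M) C
        omega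
      obtain ⟨c, hc⟩ : C.Nonempty := Finset.card_pos.mp hCpos
      have hce := Finset.card_erase_of_mem hc
      have h3 := hgirth (C.erase c) ((Finset.erase_subset c C).trans hCg) (by omega)
      have h4 : rkN M (C.erase c) ≤ rkN M C := rkN_mono (Finset.erase_subset c C)
      omega
    have hC3 : 3 ≤ C.card := by
      by_contra h
      push Not at h
      exact hCr (hsimple' C hCg (by omega))
    -- the four girths
    rcases (by omega : C.card = 3 ∨ C.card = 4 ∨ C.card = 5 ∨ C.card = 6) with h3 | h4 | h5 | h6
    · rcases Nat.lt_or_ge q 4 with hq4 | hq4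
      · have hs := hsize 3 (by norm_num) (by omega)
        have hg := indep_of_forall_rkN (g := 3) (fun X hXg hXc => hgirth X hXg (by omega))
        exact ⟨ThinRow.profileIneq_succ_of_thin_size q 3 (by norm_num) hs hg hthin,
          ThinRow.hallIneq_succ_of_thin_size q 3 (by norm_num) hs hg hthin⟩
      · exact ThinTriangle.profileIneq_thinTriangle q hq4 hsimple' hthin C hCg h3 (by omega)
    · rcases Nat.lt_or_ge q 6 with hq6 | hq6
      · have hs := hsize 4 (by norm_num) (by omega)
        have hg := indep_of_forall_rkN (g := 4) (fun X hXg hXc => hgirth X hXg (by omega))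
        exact ⟨ThinRow.profileIneq_succ_of_thin_size q 4 (by norm_num) hs hg hthin,
          ThinRow.hallIneq_succ_of_thin_size q 4 (by norm_num) hs hg hthin⟩
      · exact profileIneq_thinFour q hq6 (fun X hXg hXc => hgirth X hXg (by omega)) hthin C hCg h4 (by omega)
    · rcases Nat.lt_or_ge q 9 with hq9 | hq9
      · have hs := hsize 5 (by norm_num) (by omega)
        have hg := indep_of_forall_rkN (g := 5) (fun X hXg hXc => hgirth X hXg (by omega))
        exact ⟨ThinRow.profileIneq_succ_of_thin_size q 5 (by norm_num) hs hg hthin,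
          ThinRow.hallIneq_succ_of_thin_size q 5 (by norm_num) hs hg hthin⟩
      · exact profileIneq_thinFive q hq9 (fun X hXg hXc => hgirth X hXg (by omega)) hthin C hCg h5 (by omega)
    · rcases Nat.lt_or_ge q 12 with hq12 | hq12
      · have hs := hsize 6 (by norm_num) (by omega)
        have hg := indep_of_forall_rkN (g := 6) (fun X hXg hXc => hgirth X hXg (by omega))
        exact ⟨ThinRow.profileIneq_succ_of_thin_size q 6 (by norm_num) hs hg hthin,
          ThinRow.hallIneq_succ_of_thin_size q 6 (by norm_num) hs hg hthin⟩
      · exact profileIneq_thinSix q hq12 (fun X hXg hXc => hgirth X hXg (by omega)) hthin C hCg h6 (by omega)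

/-- The thin regime of simple matroids, `q ≤ 35`: the row alone. -/
theorem profileIneq_thin_simple' (q : ℕ) (hq : q ≤ 35)
    (hsimple : ∀ T ⊆ M.E, T.encard ≤ 2 → M.Indep T)
    (hthin : ∀ X ⊆ gr M, rkN M X = q → X.card ≤ q + 1) :
    Profile.ProfileIneq M q (q + 1) :=
  (profileIneq_thin_simple q hq hsimple hthin).1

/-- The thin regime of simple matroids, `q ≤ 35`: the Hall form (C-033). -/
theorem hallIneq_thin_simple (q : ℕ) (hq : q ≤ 35)
    (hsimple : ∀ T ⊆ M.E, T.encard ≤ 2 → M.Indep T)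
    (hthin : ∀ X ⊆ gr M, rkN M X = q → X.card ≤ q + 1) :
    Profile.HallIneq M q (q + 1) :=
  (profileIneq_thin_simple q hq hsimple hthin).2

/-- The row `(6, 7)` on every thin(6) simple matroid — every `n`, every girth. -/
theorem profileIneq_six_seven_thin_simple (hsimple : ∀ T ⊆ M.E, T.encard ≤ 2 → M.Indep T)
    (hthin : ∀ X ⊆ gr M, rkN M X = 6 → X.card ≤ 7) : Profile.ProfileIneq M 6 7 :=
  profileIneq_thin_simple' 6 (by norm_num) hsimple hthin

/-- The row `(12, 13)` on every thin(12) simple matroid — every `n`, every girth. -/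
theorem profileIneq_twelve_thirteen_thin_simple (hsimple : ∀ T ⊆ M.E, T.encard ≤ 2 → M.Indep T)
    (hthin : ∀ X ⊆ gr M, rkN M X = 12 → X.card ≤ 13) : Profile.ProfileIneq M 12 13 :=
  profileIneq_thin_simple' 12 (by norm_num) hsimple hthin

end ThinGirth
end PercRepro
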